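import Literature.NumberTheory.EllipticCurves.TwoAdicImageSurjectivityProofs
import Literature.NumberTheory.EllipticCurves.TwoAdicImageSurjectivityModTwoProofs
import Literature.NumberTheory.EllipticCurves.TateModuleGaloisTransportProofs
import Literature.NumberTheory.GaloisRepresentations.ModNCyclotomicCharacter
import HarnessLib

/-!
# The `ℚ → K` transfer of `2`-power surjectivity, II: transport along `E(ℚ̄) ≃ E_K(K̄)`, the `E[2]`-link,
# and `Δ, −Δ, 2Δ, −2Δ ∉ ℚ²` from `ρ̄_{E,8}` onto

Route `GenusKolyvaginAtTwo` (BirchSwinnertonDyer), seat `bsd-line-gk2-p3` g15 (cell `bsd-f1-sign2`),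
`--supports stmt-BirchSwinnertonDyer-28029` (helper; closes nothing). THEOREMS ONLY (no definition, no named
fact, no `sorry`). BSD is not proved by any of this. Second of three files (I = `…TwoPowerImageOverKWitness`,
III = `…TwoPowerImageOverK`); the group theory is `…TwoPowerImageOverKGroup`.

* §1 `hasSurjectiveModNGaloisRep_baseChange_of_forall_exists'` — transport of surjectivity of `ρ̄_{E,n}` to
  a base change `E_L` along the equivariant `E(F̄) ≃ E_L(L̄)` (verbatim the tree's
  `ThreeAdicImageOverK.hasSurjectiveModNGaloisRep_baseChange_of_forall_exists`, re-proved here so that this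
  lineage's import cone stays inside `Literature`);
* §2 `sign_permGal_eq_neg_one_iff` — the `E[2]`-LINK: for `r : Γ_ℚ → GL₂(ℤ/2)` and a frame `g₁ : (ℤ/2)² ≃ E[2]`
  with `σ • g₁ v = g₁ (r σ · v)` (e.g. `r = ρ mod 2` for a frame of `E[8]`, tree
  `exists_frame_torsion_of_frame_pow`), `σ` permutes `E[2] ∖ 0` by a transposition iff `r σ` is an involution
  `≠ 1`; and **`not_isSquare_four_of_hasSurjectiveModNGaloisRep_eight`**: `ρ̄_{E,8}` onto ⟹
  `Δ, −Δ, 2Δ, −2Δ ∉ ℚ²` (an element above the transvection `(1 1; 0 1) ∈ GL₂(ℤ/8)` has `χ₈ = det = 1`, fixes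
  `ζ₈`, and negates `δ`, hence negates the square roots `4δ, 4δζ₈², 4δ(ζ₈+ζ₈⁷), 4δ(ζ₈+ζ₈³)`).

References: [SilvermanAEC2009] III.§7, VIII.§1; [DokchitserDokchitserMathZ2012] Theorem (1)–(3);
[SilvermanCSS1997] Ch. II §7–§8 (`det ρ̄ = χ`).
-/

set_option autoImplicit false
set_option linter.dupNamespace false

noncomputable section

open scoped Classical

namespace Summit.BirchSwinnertonDyer.BirchSwinnertonDyer.Theorems.GenusExact.TwoPowerImageOverK

open WeierstrassCurve Field
open Literature.NumberTheory.EllipticCurves Literature.NumberTheory.GaloisRepresentations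
open Literature.NumberTheory.EllipticCurves.DokchitserDokchitser2012
open scoped Matrix

universe u

/-! ## §1 Transport of surjectivity to a base change -/

section Transport

variable {F : Type u} [Field F] (W : WeierstrassCurve F) (L : Type u) [Field L] [Algebra F L]
  [Algebra.IsAlgebraic F L]

/-- **Transport of surjectivity to a base change** (verbatim the tree's
`ThreeAdicImageOverK.hasSurjectiveModNGaloisRep_baseChange_of_forall_exists`, re-proved to avoid its import
cone): if `ρ̄_{E,n}` is onto over `F` and every `γ ∈ Γ_F` agrees on `E[n]` with the restriction of some
`δ ∈ Γ_L`, then `ρ̄_{E_L,n}` is onto over `L`. [cite: SilvermanAEC2009, III.§7 and VIII.§1] -/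
theorem hasSurjectiveModNGaloisRep_baseChange_of_forall_exists' (n : ℕ)
    (hsurj : W.HasSurjectiveModNGaloisRep (n : ℤ))
    (hH : ∀ γ : absoluteGaloisGroup F, ∃ δ : absoluteGaloisGroup L,
      ∀ P : geomPoints W, P ∈ geomTorsion W (n : ℤ) → absGaloisRestrict F L δ • P = γ • P) :
    (W.baseChange L).HasSurjectiveModNGaloisRep (n : ℤ) := by
  obtain ⟨T, hT⟩ := W.exists_addEquiv_geomPoints_baseChange L
  have hmem : ∀ P : geomPoints W,
      P ∈ geomTorsion W (n : ℤ) ↔ T P ∈ geomTorsion (W.baseChange L) (n : ℤ) := by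
    intro P
    rw [AddSubgroup.torsionBy.nsmul_iff, AddSubgroup.torsionBy.nsmul_iff, ← map_nsmul,
      T.map_eq_zero_iff]
  have hmem' : ∀ Q : geomPoints (W.baseChange L),
      Q ∈ geomTorsion (W.baseChange L) (n : ℤ) ↔ T.symm Q ∈ geomTorsion W (n : ℤ) := by
    intro Q
    rw [hmem, T.apply_symm_apply]
  set Tn : geomTorsion W (n : ℤ) ≃+ geomTorsion (W.baseChange L) (n : ℤ) :=
    { toFun := fun P ↦ ⟨T P, (hmem P).mp P.2⟩
      invFun := fun Q ↦ ⟨T.symm Q, (hmem' Q).mp Q.2⟩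
      left_inv := fun P ↦ Subtype.ext (T.symm_apply_apply P)
      right_inv := fun Q ↦ Subtype.ext (T.apply_symm_apply Q)
      map_add' := fun P Q ↦ Subtype.ext (by
        change T ((P : geomPoints W) + Q) = T P + T Q
        exact map_add T (P : geomPoints W) Q) } with hTn
  have hTn_symm_coe : ∀ Q : geomTorsion (W.baseChange L) (n : ℤ),
      ((Tn.symm Q : geomTorsion W (n : ℤ)) : geomPoints W) = T.symm Q := fun _ ↦ rfl
  intro φ
  set ψ : geomTorsion (W.baseChange L) (n : ℤ) ≃+ geomTorsion (W.baseChange L) (n : ℤ) :=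
    Multiplicative.toAdd φ with hψ
  set ψ' : geomTorsion W (n : ℤ) ≃+ geomTorsion W (n : ℤ) := (Tn.trans ψ).trans Tn.symm with hψ'
  obtain ⟨γ, hγ⟩ := hsurj (Multiplicative.ofAdd ψ')
  have hγP : ∀ P : geomTorsion W (n : ℤ), γ • P = ψ' P := fun P ↦ by
    rw [← galoisRepTorsion_apply W (n : ℤ) γ P, hγ]
    rfl
  obtain ⟨δ, hδ⟩ := hH γ
  refine ⟨δ, ?_⟩
  apply Multiplicative.toAdd.injective
  refine AddEquiv.ext fun Q ↦ Subtype.ext ?_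
  change ((galoisRepTorsion (W.baseChange L) (n : ℤ) δ).toAdd Q : geomPoints (W.baseChange L)) =
    (ψ Q : geomPoints (W.baseChange L))
  rw [galoisRepTorsion_apply, AddSubgroup.torsionBy.coe_smul]
  set P : geomTorsion W (n : ℤ) := Tn.symm Q with hP
  have hQ : (Q : geomPoints (W.baseChange L)) = T (P : geomPoints W) := by
    rw [hP]; exact (T.apply_symm_apply Q).symm
  rw [hQ, ← hT δ P, hδ (P : geomPoints W) P.2]
  have h1 : γ • (P : geomPoints W) = ((ψ' P : geomTorsion W (n : ℤ)) : geomPoints W) := by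
    rw [← AddSubgroup.torsionBy.coe_smul, hγP P]
  rw [h1, hψ', AddEquiv.trans_apply, AddEquiv.trans_apply, hP, AddEquiv.apply_symm_apply,
    hTn_symm_coe, T.apply_symm_apply]

end Transport

/-! ## §2 The `E[2]`-link and the rational non-squares -/

section Link

variable (W : WeierstrassCurve ℚ) [W.IsElliptic]

/-- In `S₃`: the elements of sign `−1` are exactly the involutions `≠ 1`. [folklore] -/
private theorem sign_eq_neg_one_iff_perm (p : Equiv.Perm (Fin 3)) :
    Equiv.Perm.sign p = -1 ↔ p * p = 1 ∧ p ≠ 1 := by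
  revert p; decide

/-- `σ` acts trivially on `E[2]` iff `permGal σ = 1`. [folklore] -/
private theorem permGal_eq_one_iff (h2 : (2 : ℚ) ≠ 0) (σ : absoluteGaloisGroup ℚ) :
    permGal W h2 σ = 1 ↔ ∀ P : geomTorsion W 2, σ • P = P := by
  constructor
  · intro h P
    rcases eq_zero_or_eq_T W h2 P with rfl | ⟨i, rfl⟩
    · exact smul_zero σ
    · rw [← T_permGal, h, Equiv.Perm.one_apply]
  · intro h
    have hρ : rho W σ = rho W 1 := AddEquiv.ext fun P ↦ by rw [rho_apply, rho_apply, one_smul, h]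
    change perm W h2 (rho W σ) = 1
    rw [hρ]
    exact permGal_one W h2

/-- **The `E[2]`-link.** Let `r : Γ_ℚ → GL₂(ℤ/2)` and a frame `g₁ : (ℤ/2)² ≃ E[2]` with
`σ • g₁ v = g₁ (r(σ) v)` (for a frame of `E[8]` with matrix representation `ρ`: `r = ρ mod 2`, tree
`exists_frame_torsion_of_frame_pow`). Then `σ` permutes the non-zero `2`-torsion points by a transposition
(`sign = −1`) iff `r(σ)` is an involution `≠ 1`. [cite: SilvermanAEC2009, III.§7] -/
theorem sign_permGal_eq_neg_one_iff (h2 : (2 : ℚ) ≠ 0)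
    (r : absoluteGaloisGroup ℚ →* GL (Fin 2) (ZMod 2)) (g₁ : (Fin 2 → ZMod 2) ≃+ geomTorsion W 2)
    (hg₁ : ∀ (σ : absoluteGaloisGroup ℚ) (v : Fin 2 → ZMod 2),
      σ • g₁ v = g₁ (((r σ : GL (Fin 2) (ZMod 2)) : Matrix (Fin 2) (Fin 2) (ZMod 2)) *ᵥ v))
    (σ : absoluteGaloisGroup ℚ) :
    Equiv.Perm.sign (permGal W h2 σ) = -1 ↔ r σ * r σ = 1 ∧ r σ ≠ 1 := by
  rw [sign_eq_neg_one_iff_perm, ← permGal_mul]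
  -- `τ` acts trivially on `E[2]` iff `r τ = 1`
  have key : ∀ τ : absoluteGaloisGroup ℚ, permGal W h2 τ = 1 ↔ r τ = 1 := by
    intro τ
    rw [permGal_eq_one_iff]
    constructor
    · intro h
      have hv : ∀ v : Fin 2 → ZMod 2,
          ((r τ : GL (Fin 2) (ZMod 2)) : Matrix (Fin 2) (Fin 2) (ZMod 2)) *ᵥ v =
            ((1 : GL (Fin 2) (ZMod 2)) : Matrix (Fin 2) (Fin 2) (ZMod 2)) *ᵥ v := fun v ↦ by
        apply g₁.injective
        rw [← hg₁, h, Units.val_one, Matrix.one_mulVec]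
      refine Units.ext (Matrix.ext fun i j ↦ ?_)
      have := congrFun (hv (Pi.single j 1)) i
      rwa [Matrix.mulVec_single_one, Matrix.mulVec_single_one] at this
    · intro h P
      obtain ⟨v, rfl⟩ := g₁.surjective P
      rw [hg₁, h, Units.val_one, Matrix.one_mulVec]
  simp only [ne_eq]
  rw [key, key, map_mul]

/-- `Γ_ℚ` fixes the rationals of `ℚ̄`. [folklore] -/
private theorem smul_algebraMap' (σ : absoluteGaloisGroup ℚ) (q : ℚ) :
    σ • algebraMap ℚ (AlgebraicClosure ℚ) q = algebraMap ℚ (AlgebraicClosure ℚ) q := by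
  rw [Field.absoluteGaloisGroup.smul_def]; exact AlgEquiv.commutes _ q

/-- A non-zero `x ∈ ℚ̄` NEGATED by some `σ ∈ Γ_ℚ` is not the square root of a rational square. [folklore] -/
private theorem not_isSquare_of_smul_eq_neg {m : ℚ} {x : AlgebraicClosure ℚ} (hx0 : x ≠ 0)
    (hx : x ^ 2 = algebraMap ℚ (AlgebraicClosure ℚ) m) {σ : absoluteGaloisGroup ℚ} (hσ : σ • x = -x) :
    ¬ IsSquare m := by
  rintro ⟨q, rfl⟩
  have hsq : x ^ 2 = (algebraMap ℚ (AlgebraicClosure ℚ) q) ^ 2 := by rw [hx, map_mul, sq]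
  have hfix : σ • x = x := by
    rcases eq_or_eq_neg_of_sq_eq_sq _ _ hsq with h | h
    · rw [h, smul_algebraMap']
    · rw [h, smul_neg, smul_algebraMap']
  rw [hfix] at hσ
  have h2x : (2 : AlgebraicClosure ℚ) * x = 0 := by linear_combination hσ
  exact hx0 ((mul_eq_zero.mp h2x).resolve_left two_ne_zero)

/-- `ζ₈⁴ = −1` (copy of the private lemma of the sibling file). [folklore] -/
private theorem zeta_pow_four' {ζ : AlgebraicClosure ℚ} (hζ : IsPrimitiveRoot ζ 8) : ζ ^ 4 = -1 := by
  have h8 : ζ ^ 4 * ζ ^ 4 = 1 := by rw [← pow_add]; exact hζ.pow_eq_one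
  have h4 : ζ ^ 4 ≠ 1 := hζ.pow_ne_one_of_pos_of_lt (by norm_num) (by norm_num)
  rcases mul_self_eq_one_iff.mp h8 with h | h
  · exact absurd h h4
  · exact h

/-- `(ζ₈²)² = −1`, `(ζ₈ + ζ₈⁷)² = 2`, `(ζ₈ + ζ₈³)² = −2` (copy of the sibling file's private lemma). [folklore] -/
private theorem gens_sq' {ζ : AlgebraicClosure ℚ} (hζ : IsPrimitiveRoot ζ 8) :
    (ζ ^ 2) ^ 2 = -1 ∧ (ζ + ζ ^ 7) ^ 2 = 2 ∧ (ζ + ζ ^ 3) ^ 2 = -2 := by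
  have h4 := zeta_pow_four' hζ
  have h8 : ζ ^ 8 = 1 := hζ.pow_eq_one
  refine ⟨?_, ?_, ?_⟩
  · rw [← pow_mul]; exact h4
  · have e : (ζ + ζ ^ 7) ^ 2 = ζ ^ 2 + 2 * ζ ^ 8 + ζ ^ 8 * ζ ^ 6 := by ring
    rw [e, h8]
    linear_combination ζ ^ 2 * h4
  · have e : (ζ + ζ ^ 3) ^ 2 = ζ ^ 2 + 2 * ζ ^ 4 + ζ ^ 6 := by ring
    rw [e]
    linear_combination (2 + ζ ^ 2) * h4

/-- An element with `χ₈ = 1` fixes `ζ₈`, hence `ζ₈², ζ₈ + ζ₈⁷, ζ₈ + ζ₈³`. [folklore] -/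
private theorem smul_gens_of_cyclotomic_eq_one {ζ : AlgebraicClosure ℚ} (hζ : IsPrimitiveRoot ζ 8)
    (σ : absoluteGaloisGroup ℚ) (h : modNCyclotomicCharacter ℚ 8 σ = 1) :
    σ • ζ ^ 2 = ζ ^ 2 ∧ σ • (ζ + ζ ^ 7) = ζ + ζ ^ 7 ∧ σ • (ζ + ζ ^ 3) = ζ + ζ ^ 3 := by
  haveI : NeZero ((8 : ℕ) : ℚ) := ⟨by norm_num⟩
  haveI : Fact (1 < 8) := ⟨by norm_num⟩
  have hz : σ • ζ = ζ := by
    rw [modNCyclotomicCharacter_spec ℚ 8 σ ζ hζ.pow_eq_one, h, Units.val_one, ZMod.val_one, pow_one]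
  refine ⟨?_, ?_, ?_⟩ <;> simp only [smul_pow', smul_add, hz]

/-- The transvection `(1 1; 0 1)` modulo `2` squares to `1`. [folklore] -/
private theorem transvection_two_mul_self :
    (!![1, 1; 0, 1] : Matrix (Fin 2) (Fin 2) (ZMod 2)) * !![1, 1; 0, 1] = 1 := by decide

/-- The transvection `(1 1; 0 1)` modulo `2` is not `1`. [folklore] -/
private theorem transvection_two_apply_ne :
    (!![1, 1; 0, 1] : Matrix (Fin 2) (Fin 2) (ZMod 2)) 0 1 ≠ (1 : Matrix (Fin 2) (Fin 2) (ZMod 2)) 0 1 := by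
  decide

/-- Reduction modulo `2` of the entries of `(1 1; 0 1) ∈ M₂(ℤ/8)`. [folklore] -/
private theorem castHom_transvection_apply (i j : Fin 2) :
    ZMod.castHom (show 2 ∣ 8 by norm_num) (ZMod 2) ((!![1, 1; 0, 1] : Matrix (Fin 2) (Fin 2) (ZMod 8)) i j) =
      (!![1, 1; 0, 1] : Matrix (Fin 2) (Fin 2) (ZMod 2)) i j := by
  revert i j; decide

/-- **`ρ̄_{E,8}` onto over `ℚ` forces `Δ, −Δ, 2Δ, −2Δ ∉ ℚ²`** (the "only if" halves of Dokchitser–Dokchitser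
2012, Thm. (1)–(3)): an element `σ` mapping to the transvection `(1 1; 0 1) ∈ GL₂(ℤ/8)` has `χ₈(σ) = det = 1`
(Weil pairing), so fixes `ζ₈`, and acts on `E[2]` as a transposition, so negates `δ`; hence it negates the
square roots `4δ, 4δζ₈², 4δ(ζ₈+ζ₈⁷), 4δ(ζ₈+ζ₈³)` of `Δ, −Δ, 2Δ, −2Δ`, none of which can then be rational.
[cite: DokchitserDokchitserMathZ2012, Theorem (1)–(3) (only if)] [cite: SilvermanCSS1997, Ch. II §7–§8 (det ρ̄ = χ)] -/
theorem not_isSquare_four_of_hasSurjectiveModNGaloisRep_eight (hsurj : W.HasSurjectiveModNGaloisRep 8) :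
    ¬ IsSquare W.Δ ∧ ¬ IsSquare (-W.Δ) ∧ ¬ IsSquare (2 * W.Δ) ∧ ¬ IsSquare (-2 * W.Δ) := by
  haveI : Fact (Nat.Prime 2) := ⟨Nat.prime_two⟩
  haveI : NeZero ((8 : ℕ) : ℚ) := ⟨by norm_num⟩
  haveI : NeZero ((8 : ℕ) : AlgebraicClosure ℚ) := ⟨by norm_num⟩
  have h2Q : ((2 : ℕ) : ℚ) ≠ 0 := by norm_num
  have h2Q' : (2 : ℚ) ≠ 0 := two_ne_zero
  obtain ⟨ζ, hζ⟩ := HasEnoughRootsOfUnity.exists_primitiveRoot (AlgebraicClosure ℚ) 8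
  have hsurj' : W.HasSurjectiveModNGaloisRep ((2 ^ 3 : ℕ) : ℤ) := by exact_mod_cast hsurj
  obtain ⟨e⟩ := nonempty_addEquiv_geomTorsion W 2 3 (by norm_num) h2Q
  obtain ⟨ρ, hρ⟩ := exists_rep_of_addEquiv W e
  have hρs := rep_surjective_of_hasSurjectiveModNGaloisRep W e ρ hρ hsurj'
  obtain ⟨g₁, hg₁⟩ := exists_frame_torsion_of_frame_pow W 2 1 2 h2Q e ρ hρ
  set red : GL (Fin 2) (ZMod (2 ^ (1 + 2))) →* GL (Fin 2) (ZMod (2 ^ 1)) :=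
    Matrix.GeneralLinearGroup.map (ZMod.castHom (pow_dvd_pow 2 (Nat.le_add_right 1 2)) (ZMod (2 ^ 1)))
    with hred_def
  -- the transvection and a Galois element above it
  set u : GL (Fin 2) (ZMod 8) := ⟨!![1, 1; 0, 1], !![1, -1; 0, 1], by decide, by decide⟩ with hu
  obtain ⟨σ, hσ⟩ := hρs u
  -- `χ₈(σ) = det u = 1`
  have hχ : modNCyclotomicCharacter ℚ 8 σ = 1 := by
    have hd' : ((ρ σ : GL (Fin 2) (ZMod (2 ^ 3))) : Matrix (Fin 2) (Fin 2) (ZMod (2 ^ 3))).det =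
        ((modNCyclotomicCharacter ℚ 8 σ : (ZMod 8)ˣ) : ZMod 8) :=
      det_eq_modNCyclotomicCharacter W (2 ^ 3) (by norm_num) e σ _ (hρ σ)
    refine Units.ext ?_
    rw [← hd', hσ, hu, Units.val_one, Matrix.det_fin_two_of]
    norm_num
  -- the reduction of `u` modulo `2`
  have hredq : ∀ (g : GL (Fin 2) (ZMod 8)) (i j : Fin 2), (red g : Matrix (Fin 2) (Fin 2) (ZMod 2)) i j =
      ZMod.castHom (show 2 ∣ 8 by norm_num) (ZMod 2) ((g : Matrix (Fin 2) (Fin 2) (ZMod 8)) i j) :=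
    fun g i j ↦ rfl
  have hru : ((red u : GL (Fin 2) (ZMod 2)) : Matrix (Fin 2) (Fin 2) (ZMod 2)) = !![1, 1; 0, 1] := by
    ext i j
    rw [hredq u i j, hu]
    exact castHom_transvection_apply i j
  -- `σ` is a transposition on `E[2]`
  have hsign : Equiv.Perm.sign (permGal W h2Q' σ) = -1 := by
    rw [sign_permGal_eq_neg_one_iff W h2Q' (red.comp ρ) g₁ (fun τ v ↦ hg₁ τ v) σ, MonoidHom.comp_apply,
      hσ]
    constructor
    · refine Units.ext ?_
      rw [Units.val_mul, hru, Units.val_one]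
      exact transvection_two_mul_self
    · intro h1
      have := congrArg (fun g : GL (Fin 2) (ZMod 2) ↦ (g : Matrix (Fin 2) (Fin 2) (ZMod 2)) 0 1) h1
      rw [hru] at this
      exact transvection_two_apply_ne this
  have hδ : σ • delta W h2Q' = -delta W h2Q' := by
    rw [smul_delta, hsign, Units.val_neg, Units.val_one, Int.cast_neg, Int.cast_one, neg_one_mul]
  obtain ⟨hi, hr, hm⟩ := smul_gens_of_cyclotomic_eq_one hζ σ hχ
  obtain ⟨hi2, hr2, hm2⟩ := gens_sq' hζ
  have hΔδ : algebraMap ℚ (AlgebraicClosure ℚ) W.Δ = 16 * delta W h2Q' ^ 2 := algebraMap_Δ W h2Q'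
  have hδ0 : delta W h2Q' ≠ 0 := delta_ne_zero W h2Q'
  have h40 : (4 : AlgebraicClosure ℚ) ≠ 0 := by norm_num
  have hi0 : ζ ^ 2 ≠ 0 := fun h ↦ by rw [h] at hi2; norm_num at hi2
  have hr0 : ζ + ζ ^ 7 ≠ 0 := fun h ↦ by rw [h] at hr2; norm_num at hr2
  have hm0 : ζ + ζ ^ 3 ≠ 0 := fun h ↦ by rw [h] at hm2; norm_num at hm2
  have smul4 : σ • (4 : AlgebraicClosure ℚ) = 4 := by
    rw [Field.absoluteGaloisGroup.smul_def]; exact map_ofNat _ 4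
  refine ⟨?_, ?_, ?_, ?_⟩
  · refine not_isSquare_of_smul_eq_neg (x := 4 * delta W h2Q') (mul_ne_zero h40 hδ0) (by rw [hΔδ]; ring)
      (σ := σ) ?_
    rw [smul_mul', smul4, hδ]; ring
  · refine not_isSquare_of_smul_eq_neg (x := 4 * delta W h2Q' * ζ ^ 2)
      (mul_ne_zero (mul_ne_zero h40 hδ0) hi0) (by rw [map_neg, hΔδ, mul_pow, hi2]; ring) (σ := σ) ?_
    rw [smul_mul', smul_mul', smul4, hδ, hi]; ring
  · refine not_isSquare_of_smul_eq_neg (x := 4 * delta W h2Q' * (ζ + ζ ^ 7))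
      (mul_ne_zero (mul_ne_zero h40 hδ0) hr0) (by rw [map_mul, hΔδ, mul_pow, hr2, map_ofNat]; ring)
      (σ := σ) ?_
    rw [smul_mul', smul_mul', smul4, hδ, hr]; ring
  · refine not_isSquare_of_smul_eq_neg (x := 4 * delta W h2Q' * (ζ + ζ ^ 3))
      (mul_ne_zero (mul_ne_zero h40 hδ0) hm0) (by rw [map_mul, map_neg, hΔδ, mul_pow, hm2, map_ofNat]; ring)
      (σ := σ) ?_
    rw [smul_mul', smul_mul', smul4, hδ, hm]; ring

end Link

end Summit.BirchSwinnertonDyer.BirchSwinnertonDyer.Theorems.GenusExact.TwoPowerImageOverK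

end
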